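import Summits.ResolutionOfSingularities.ResolutionOfSingularities.Theses.AbhyankarShadows
import Summits.ResolutionOfSingularities.ResolutionOfSingularities.Theses.IndSmooth
import Summits.ResolutionOfSingularities.ResolutionOfSingularities.Theorems.AbhyankarShadowsRationalSuffices
import Literature.AlgebraicGeometry.Resolution.NonReducedNoResolution
import Literature.AlgebraicGeometry.Resolution.AbsoluteIntegralClosureNoResolution

/-!
# Negative lemmas for crux `PatchingPerfect` (stmt-ResolutionOfSingularities-16089):
# the CONSEQUENT's side conditions are load-bearing (natural strengthenings refuted)

The consequent of `PatchingPerfect` at `(p, k)` is weak resolution (`Scheme.HasResolution`) of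
every REDUCED separated `k`-scheme of FINITE TYPE. Standing disprover, cycle 1
(`Cruxes/PatchingPerfect/Disproof.lean` §3), all unconditional and fieldwise:

* (C1) `IsReduced` dropped — the consequent is FALSE over every field
  (`patchingPerfect_not_resolves_noReduced`, witness `Spec k[ε]`, tree
  `not_hasResolution_spec_dualNumber`), so that variant of the crux is the NEGATION of its own
  antecedent over every perfect field (`patchingPerfect_withoutReduced_iff`) and is INCONSISTENT
  with the rest of both routes: with `IndSmooth.LurelPerfect` (stmt-16086,
  `patchingPerfect_withoutReduced_refutes_lurelPerfect`, at `𝔽₂`) and with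
  `SemivaluationShadows ∧ ShadowsUniformize` of `AbhyankarShadows`
  (`patchingPerfect_withoutReduced_inconsistent_shadows`, at `𝔽₂^alg`, using the landed
  `Theorems.rationalSuffices_proof` for the support `RationalSuffices`);
* (C2) `LocallyOfFiniteType` dropped — FALSE over every field (`patchingPerfect_not_resolves_noFT`,
  witness `Spec k[X]⁺`, the integral closure of `k[X]` in an algebraic closure of `k(X)`:
  root-closed, hence Noetherian — let alone regular — at the generic point only, which is not
  open; the tree's `𝔽_p` witness `AbsoluteIntegralClosureNoResolution.lean` carried over verbatim
  to an arbitrary field), with the same two inconsistency corollaries.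
* `QuasiCompact` / `IsSeparated` dropped: not refutable and not provably harmless without
  functorial resolution; not formalised.
-/

noncomputable section

set_option linter.dupNamespace false

open CategoryTheory AlgebraicGeometry
open Literature.AlgebraicGeometry.Resolution
open Summit.ResolutionOfSingularities.ResolutionOfSingularities.Theses
open Summit.ResolutionOfSingularities.ResolutionOfSingularities.Theses.AbhyankarShadows
  (PatchingPerfect SemivaluationShadows ShadowsUniformize RationalSuffices)

namespace Summit.ResolutionOfSingularities.ResolutionOfSingularities.Theorems.PatchingPerfect.Negative

/-! ## (C1) `IsReduced` -/

/-- **(C1) Over EVERY field the consequent without `IsReduced` is false**: `Spec k[ε] → Spec k`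
is affine of finite type and `Spec k[ε]` has no resolution (a regular stalk on the dense open
would be a domain, but `ε/1` is a non-zero nilpotent). [cite: Matsumura1987, Thm. 14.3] -/
theorem patchingPerfect_not_resolves_noReduced (k : Type) [Field k] :
    ¬ (∀ (X : Scheme.{0}) (f : X ⟶ Spec (.of k)), IsSeparated f → LocallyOfFiniteType f →
      QuasiCompact f → Scheme.HasResolution X) := by
  intro h
  haveI : Module.Finite k (DualNumber k) := inferInstanceAs (Module.Finite k (k × k))
  let f : Spec (.of (DualNumber k)) ⟶ Spec (.of k) :=
    Spec.map (CommRingCat.ofHom (algebraMap k (DualNumber k)))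
  haveI : LocallyOfFiniteType f :=
    (HasRingHomProperty.Spec_iff (P := @LocallyOfFiniteType)).mpr
      (RingHom.finiteType_algebraMap.mpr inferInstance)
  exact not_hasResolution_spec_dualNumber k (h _ f inferInstance inferInstance inferInstance)

/-- **(C1) `IsReduced` is load-bearing: dropped from the consequent, the crux becomes the
NEGATION of its own antecedent over every perfect field of every prime characteristic.**
[folklore] -/
theorem patchingPerfect_withoutReduced_iff :
    (∀ p : ℕ, p.Prime → ∀ (k : Type) [Field k] [CharP k p] [PerfectField k],
      (∀ (K : Type) [Field K] [Algebra k K], (⊤ : IntermediateField k K).FG →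
      ∀ O : ValuationSubring K, (∀ c : k, algebraMap k K c ∈ O) → ∀ R : Subalgebra k K, R.FG →
        R.toSubring ≤ O.toSubring → ∃ (A : Subalgebra k K) (h : A.toSubring ≤ O.toSubring),
          R ≤ A ∧ A.FG ∧ IsFractionRing A K ∧ IsRegularLocalRing (Localization.AtPrime
            (Ideal.comap (Subring.inclusion h) (IsLocalRing.maximalIdeal O)))) →
      (∀ (X : Scheme.{0}) (f : X ⟶ Spec (.of k)), IsSeparated f → LocallyOfFiniteType f →
      QuasiCompact f → Scheme.HasResolution X)) ↔
    ∀ p : ℕ, p.Prime → ∀ (k : Type) [Field k] [CharP k p] [PerfectField k],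
      ¬ (∀ (K : Type) [Field K] [Algebra k K], (⊤ : IntermediateField k K).FG →
      ∀ O : ValuationSubring K, (∀ c : k, algebraMap k K c ∈ O) → ∀ R : Subalgebra k K, R.FG →
        R.toSubring ≤ O.toSubring → ∃ (A : Subalgebra k K) (h : A.toSubring ≤ O.toSubring),
          R ≤ A ∧ A.FG ∧ IsFractionRing A K ∧ IsRegularLocalRing (Localization.AtPrime
            (Ideal.comap (Subring.inclusion h) (IsLocalRing.maximalIdeal O)))) :=
  ⟨fun h p hp k _ _ _ hLU => patchingPerfect_not_resolves_noReduced k (h p hp k hLU),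
    fun h p hp k _ _ _ hLU => absurd hLU (h p hp k)⟩

/-- **(C1) … hence that variant REFUTES route `IndSmooth`'s target `LurelPerfect`** (relative LU
over all perfect fields), at `k = 𝔽₂`. [folklore] -/
theorem patchingPerfect_withoutReduced_refutes_lurelPerfect
    (h : ∀ p : ℕ, p.Prime → ∀ (k : Type) [Field k] [CharP k p] [PerfectField k],
      (∀ (K : Type) [Field K] [Algebra k K], (⊤ : IntermediateField k K).FG →
      ∀ O : ValuationSubring K, (∀ c : k, algebraMap k K c ∈ O) → ∀ R : Subalgebra k K, R.FG →
        R.toSubring ≤ O.toSubring → ∃ (A : Subalgebra k K) (h : A.toSubring ≤ O.toSubring),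
          R ≤ A ∧ A.FG ∧ IsFractionRing A K ∧ IsRegularLocalRing (Localization.AtPrime
            (Ideal.comap (Subring.inclusion h) (IsLocalRing.maximalIdeal O)))) →
      (∀ (X : Scheme.{0}) (f : X ⟶ Spec (.of k)), IsSeparated f → LocallyOfFiniteType f →
      QuasiCompact f → Scheme.HasResolution X)) :
    ¬ IndSmooth.LurelPerfect := by
  intro hL
  haveI : Fact (Nat.Prime 2) := ⟨Nat.prime_two⟩
  exact patchingPerfect_withoutReduced_iff.mp h 2 Nat.prime_two (ZMod 2)
    (fun K _ _ => hL 2 Nat.prime_two (ZMod 2) K)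

/-- Route `AbhyankarShadows`'s cruxes `SemivaluationShadows`, `ShadowsUniformize` and its support
`RationalSuffices` yield relative LU over every ALGEBRAICALLY CLOSED field of characteristic `p`
(the inner term of that route's deciding theorem). [folklore] -/
theorem relLU_of_shadows (h1 : SemivaluationShadows) (h2 : ShadowsUniformize)
    (h3 : RationalSuffices) (p : ℕ) (hp : p.Prime) (k : Type) [Field k] [CharP k p]
    [IsAlgClosed k] :
    (∀ (K : Type) [Field K] [Algebra k K], (⊤ : IntermediateField k K).FG →
      ∀ O : ValuationSubring K, (∀ c : k, algebraMap k K c ∈ O) → ∀ R : Subalgebra k K, R.FG →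
        R.toSubring ≤ O.toSubring → ∃ (A : Subalgebra k K) (h : A.toSubring ≤ O.toSubring),
          R ≤ A ∧ A.FG ∧ IsFractionRing A K ∧ IsRegularLocalRing (Localization.AtPrime
            (Ideal.comap (Subring.inclusion h) (IsLocalRing.maximalIdeal O)))) :=
  h3 p hp k (fun K _ _ hfg O hO hrat R hR hRO =>
    h2 p hp k K hfg O hO hrat R hR hRO (fun F => h1 p hp k K hfg O hO hrat R hR hRO F))

/-- **(C1) … and that variant is INCONSISTENT with the two remaining cruxes of route
`AbhyankarShadows`** (K1 ∧ K2; the support `RationalSuffices` is the landed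
`Theorems.rationalSuffices_proof`), at the perfect field `𝔽₂^alg`. [folklore] -/
theorem patchingPerfect_withoutReduced_inconsistent_shadows
    (h : ∀ p : ℕ, p.Prime → ∀ (k : Type) [Field k] [CharP k p] [PerfectField k],
      (∀ (K : Type) [Field K] [Algebra k K], (⊤ : IntermediateField k K).FG →
      ∀ O : ValuationSubring K, (∀ c : k, algebraMap k K c ∈ O) → ∀ R : Subalgebra k K, R.FG →
        R.toSubring ≤ O.toSubring → ∃ (A : Subalgebra k K) (h : A.toSubring ≤ O.toSubring),
          R ≤ A ∧ A.FG ∧ IsFractionRing A K ∧ IsRegularLocalRing (Localization.AtPrime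
            (Ideal.comap (Subring.inclusion h) (IsLocalRing.maximalIdeal O)))) →
      (∀ (X : Scheme.{0}) (f : X ⟶ Spec (.of k)), IsSeparated f → LocallyOfFiniteType f →
      QuasiCompact f → Scheme.HasResolution X))
    (h1 : SemivaluationShadows) (h2 : ShadowsUniformize) : False := by
  haveI : Fact (Nat.Prime 2) := ⟨Nat.prime_two⟩
  exact patchingPerfect_withoutReduced_iff.mp h 2 Nat.prime_two (AlgebraicClosure (ZMod 2))
    (relLU_of_shadows h1 h2 rationalSuffices_proof 2 Nat.prime_two (AlgebraicClosure (ZMod 2)))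

/-! ## (C2) `LocallyOfFiniteType` — the witness `Spec k[X]⁺` over an arbitrary field -/

section Witness

open Polynomial

variable (k : Type) [Field k]

/-- `k[X] → k[X]⁺` is injective (it factors the injection into the algebraic closure of `k(X)`).
[folklore] -/
theorem absIntClosure_algebraMap_injective :
    Function.Injective (algebraMap k[X]
      ↥(integralClosure k[X] (AlgebraicClosure (RatFunc k)))) := by
  have h : Function.Injective (algebraMap k[X] (AlgebraicClosure (RatFunc k))) := by
    rw [IsScalarTower.algebraMap_eq k[X] (RatFunc k) (AlgebraicClosure (RatFunc k))]
    exact (algebraMap (RatFunc k) _).injective.comp (RatFunc.algebraMap_injective k)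
  intro a b hab
  apply h
  have := congrArg
    (fun x : ↥(integralClosure k[X] (AlgebraicClosure (RatFunc k))) =>
      (x : AlgebraicClosure (RatFunc k))) hab
  simpa using this

/-- **Every element of `k[X]⁺` is a square** (roots of integral elements are integral).
[folklore] -/
theorem absIntClosure_exists_sq_eq
    (a : ↥(integralClosure k[X] (AlgebraicClosure (RatFunc k)))) :
    ∃ b : ↥(integralClosure k[X] (AlgebraicClosure (RatFunc k))), b ^ 2 = a := by
  obtain ⟨z, hz⟩ := IsAlgClosed.exists_pow_nat_eq (a : AlgebraicClosure (RatFunc k)) two_pos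
  have hzint : IsIntegral k[X] z := IsIntegral.of_pow two_pos (by rw [hz]; exact a.2)
  exact ⟨⟨z, hzint⟩, Subtype.ext hz⟩

/-- **The generic point of `Spec k[X]⁺` is not open**: every non-zero `f` avoids some non-zero
prime — a prime lying over `(π)`, where `π` is an irreducible factor of `c·X + 1` and `c ≠ 0` is
the constant term of an integral equation of `f` (Stacks 00FZ for lying over). [folklore] -/
theorem absIntClosure_exists_prime_not_mem
    (f : ↥(integralClosure k[X] (AlgebraicClosure (RatFunc k)))) (hf : f ≠ 0) :
    ∃ Q : Ideal ↥(integralClosure k[X] (AlgebraicClosure (RatFunc k))),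
      Q.IsPrime ∧ Q ≠ ⊥ ∧ f ∉ Q := by
  have hinj := absIntClosure_algebraMap_injective k
  haveI : FaithfulSMul k[X] ↥(integralClosure k[X] (AlgebraicClosure (RatFunc k))) :=
    (faithfulSMul_iff_algebraMap_injective _ _).mpr hinj
  -- an integral equation of `f` with non-zero constant term `c`
  obtain ⟨P, hPm, hPf⟩ := (integralClosure.isIntegral f : IsIntegral k[X] f)
  obtain ⟨P', hP, hXP'⟩ := P.exists_eq_pow_rootMultiplicity_mul_and_not_dvd hPm.ne_zero 0
  simp only [map_zero, sub_zero] at hP hXP'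
  set c := P'.coeff 0 with hc_def
  have hc : c ≠ 0 := fun h0 => hXP' (Polynomial.X_dvd_iff.mpr h0)
  have hP'f : Polynomial.aeval f P' = 0 := by
    have h1 : Polynomial.aeval f P = 0 := hPf
    rw [hP, map_mul, map_pow, Polynomial.aeval_X] at h1
    exact (mul_eq_zero.mp h1).resolve_left (pow_ne_zero _ hf)
  have hrel : algebraMap k[X] _ c = -(Polynomial.aeval f P'.divX * f) := by
    have h1 := hP'f
    rw [← Polynomial.divX_mul_X_add P', map_add, map_mul, Polynomial.aeval_X,
      Polynomial.aeval_C] at h1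
    linear_combination h1
  -- a non-zero prime `(π)` of `k[X]` with `π ∤ c`: an irreducible factor of `c·X + 1`
  have hdeg : (c * X + 1 : k[X]).natDegree = c.natDegree + 1 := by
    rw [Polynomial.natDegree_add_eq_left_of_natDegree_lt] <;>
      rw [Polynomial.natDegree_mul_X hc]
    simp
  have hne : (c * X + 1 : k[X]) ≠ 0 := by
    intro h0; rw [h0] at hdeg; simp at hdeg
  have hnu : ¬ IsUnit (c * X + 1 : k[X]) := by
    intro hu
    have := Polynomial.natDegree_eq_zero_of_isUnit hu
    omega
  obtain ⟨π, hπirr, hπdvd⟩ := WfDvdMonoid.exists_irreducible_factor hnu hne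
  have hπc : ¬ π ∣ c := by
    intro hdc
    apply hπirr.not_isUnit
    have : π ∣ (c * X + 1) - c * X := dvd_sub hπdvd (dvd_mul_of_dvd_left hdc _)
    exact isUnit_of_dvd_one (by simpa using this)
  let 𝔭 : Ideal k[X] := Ideal.span {π}
  haveI h𝔭 : 𝔭.IsPrime := (Ideal.span_singleton_prime hπirr.ne_zero).mpr hπirr.prime
  -- lying over `𝔭`
  obtain ⟨Q, -, hQ, hQcomap⟩ := Ideal.exists_ideal_over_prime_of_isIntegral 𝔭
    (⊥ : Ideal ↥(integralClosure k[X] (AlgebraicClosure (RatFunc k))))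
    (by
      intro a ha
      have ha0 : algebraMap k[X]
          ↥(integralClosure k[X] (AlgebraicClosure (RatFunc k))) a = 0 :=
        Ideal.mem_bot.mp (Ideal.mem_comap.mp ha)
      have : a = 0 := hinj (by rw [ha0, map_zero])
      rw [this]; exact 𝔭.zero_mem)
  refine ⟨Q, hQ, ?_, ?_⟩
  · rintro rfl
    have hπmem : π ∈ (⊥ : Ideal ↥(integralClosure k[X]
        (AlgebraicClosure (RatFunc k)))).comap (algebraMap k[X] _) := by
      rw [hQcomap]; exact Ideal.mem_span_singleton_self π
    have hπ0 : algebraMap k[X]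
        ↥(integralClosure k[X] (AlgebraicClosure (RatFunc k))) π = 0 :=
      Ideal.mem_bot.mp (Ideal.mem_comap.mp hπmem)
    exact hπirr.ne_zero (hinj (by rw [hπ0, map_zero]))
  · intro hfQ
    have h1 : algebraMap k[X] _ c ∈ Q := by
      rw [hrel]; exact Q.neg_mem (Q.mul_mem_left _ hfQ)
    have h2 : c ∈ 𝔭 := by rw [← hQcomap]; exact h1
    exact hπc (Ideal.mem_span_singleton.mp h2)

/-- **`Spec k[X]⁺` has no resolution of singularities**, over every field `k` (tree
`not_hasResolution_spec_of_forall_exists_pow_eq`: a root-closed domain whose generic point is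
not open). [folklore] -/
theorem not_hasResolution_spec_absIntClosure :
    ¬ Scheme.HasResolution (Spec (.of ↥(integralClosure k[X] (AlgebraicClosure (RatFunc k))))) :=
  not_hasResolution_spec_of_forall_exists_pow_eq _ le_rfl (absIntClosure_exists_sq_eq k)
    (absIntClosure_exists_prime_not_mem k)

end Witness

/-- **(C2) Over EVERY field the consequent without `LocallyOfFiniteType` is false**:
`Spec k[X]⁺ → Spec k` is affine (separated, quasi-compact) with reduced source and no
resolution. [folklore] -/
theorem patchingPerfect_not_resolves_noFT (k : Type) [Field k] :
    ¬ (∀ (X : Scheme.{0}) (f : X ⟶ Spec (.of k)), IsSeparated f → QuasiCompact f →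
      IsReduced X → Scheme.HasResolution X) := by
  intro h
  let f : Spec (.of ↥(integralClosure (Polynomial k) (AlgebraicClosure (RatFunc k)))) ⟶
      Spec (.of k) :=
    Spec.map (CommRingCat.ofHom ((algebraMap (Polynomial k)
      ↥(integralClosure (Polynomial k) (AlgebraicClosure (RatFunc k)))).comp Polynomial.C))
  exact not_hasResolution_spec_absIntClosure k (h _ f inferInstance inferInstance inferInstance)

/-- **(C2) `LocallyOfFiniteType` is load-bearing: dropped from the consequent, the crux is again
the negation of its own antecedent over every perfect field.** [folklore] -/
theorem patchingPerfect_withoutFT_iff :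
    (∀ p : ℕ, p.Prime → ∀ (k : Type) [Field k] [CharP k p] [PerfectField k],
      (∀ (K : Type) [Field K] [Algebra k K], (⊤ : IntermediateField k K).FG →
      ∀ O : ValuationSubring K, (∀ c : k, algebraMap k K c ∈ O) → ∀ R : Subalgebra k K, R.FG →
        R.toSubring ≤ O.toSubring → ∃ (A : Subalgebra k K) (h : A.toSubring ≤ O.toSubring),
          R ≤ A ∧ A.FG ∧ IsFractionRing A K ∧ IsRegularLocalRing (Localization.AtPrime
            (Ideal.comap (Subring.inclusion h) (IsLocalRing.maximalIdeal O)))) →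
      (∀ (X : Scheme.{0}) (f : X ⟶ Spec (.of k)), IsSeparated f → QuasiCompact f →
      IsReduced X → Scheme.HasResolution X)) ↔
    ∀ p : ℕ, p.Prime → ∀ (k : Type) [Field k] [CharP k p] [PerfectField k],
      ¬ (∀ (K : Type) [Field K] [Algebra k K], (⊤ : IntermediateField k K).FG →
      ∀ O : ValuationSubring K, (∀ c : k, algebraMap k K c ∈ O) → ∀ R : Subalgebra k K, R.FG →
        R.toSubring ≤ O.toSubring → ∃ (A : Subalgebra k K) (h : A.toSubring ≤ O.toSubring),
          R ≤ A ∧ A.FG ∧ IsFractionRing A K ∧ IsRegularLocalRing (Localization.AtPrime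
            (Ideal.comap (Subring.inclusion h) (IsLocalRing.maximalIdeal O)))) :=
  ⟨fun h p hp k _ _ _ hLU => patchingPerfect_not_resolves_noFT k (h p hp k hLU),
    fun h p hp k _ _ _ hLU => absurd hLU (h p hp k)⟩

/-- (C2) … refutes `IndSmooth.LurelPerfect`, at `𝔽₂`. [folklore] -/
theorem patchingPerfect_withoutFT_refutes_lurelPerfect
    (h : ∀ p : ℕ, p.Prime → ∀ (k : Type) [Field k] [CharP k p] [PerfectField k],
      (∀ (K : Type) [Field K] [Algebra k K], (⊤ : IntermediateField k K).FG →
      ∀ O : ValuationSubring K, (∀ c : k, algebraMap k K c ∈ O) → ∀ R : Subalgebra k K, R.FG →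
        R.toSubring ≤ O.toSubring → ∃ (A : Subalgebra k K) (h : A.toSubring ≤ O.toSubring),
          R ≤ A ∧ A.FG ∧ IsFractionRing A K ∧ IsRegularLocalRing (Localization.AtPrime
            (Ideal.comap (Subring.inclusion h) (IsLocalRing.maximalIdeal O)))) →
      (∀ (X : Scheme.{0}) (f : X ⟶ Spec (.of k)), IsSeparated f → QuasiCompact f →
      IsReduced X → Scheme.HasResolution X)) :
    ¬ IndSmooth.LurelPerfect := by
  intro hL
  haveI : Fact (Nat.Prime 2) := ⟨Nat.prime_two⟩
  exact patchingPerfect_withoutFT_iff.mp h 2 Nat.prime_two (ZMod 2)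
    (fun K _ _ => hL 2 Nat.prime_two (ZMod 2) K)

/-- (C2) … inconsistent with `SemivaluationShadows ∧ ShadowsUniformize` of route
`AbhyankarShadows`, at `𝔽₂^alg`. [folklore] -/
theorem patchingPerfect_withoutFT_inconsistent_shadows
    (h : ∀ p : ℕ, p.Prime → ∀ (k : Type) [Field k] [CharP k p] [PerfectField k],
      (∀ (K : Type) [Field K] [Algebra k K], (⊤ : IntermediateField k K).FG →
      ∀ O : ValuationSubring K, (∀ c : k, algebraMap k K c ∈ O) → ∀ R : Subalgebra k K, R.FG →
        R.toSubring ≤ O.toSubring → ∃ (A : Subalgebra k K) (h : A.toSubring ≤ O.toSubring),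
          R ≤ A ∧ A.FG ∧ IsFractionRing A K ∧ IsRegularLocalRing (Localization.AtPrime
            (Ideal.comap (Subring.inclusion h) (IsLocalRing.maximalIdeal O)))) →
      (∀ (X : Scheme.{0}) (f : X ⟶ Spec (.of k)), IsSeparated f → QuasiCompact f →
      IsReduced X → Scheme.HasResolution X))
    (h1 : SemivaluationShadows) (h2 : ShadowsUniformize) : False := by
  haveI : Fact (Nat.Prime 2) := ⟨Nat.prime_two⟩
  exact patchingPerfect_withoutFT_iff.mp h 2 Nat.prime_two (AlgebraicClosure (ZMod 2))
    (relLU_of_shadows h1 h2 rationalSuffices_proof 2 Nat.prime_two (AlgebraicClosure (ZMod 2)))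

end Summit.ResolutionOfSingularities.ResolutionOfSingularities.Theorems.PatchingPerfect.Negative

end
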